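import Literature.Barriers.Parity.SiegelZeroDichotomyPairHLSieveLocal
import Literature.Barriers.Parity.SiegelZeroDichotomyPairHLDivisorPairs
import Literature.Barriers.Parity.SiegelZeroDichotomyPairHLMertens33
import HarnessLib

/-!
# Tao–Teräväinen 2022, (5.8) at `k = 2`: the Euler product bound for the weighted gains

Topic `Literature/Barriers/Parity`, sub-namespace `TaoTeravainen`; the arithmetic half of the proof
of (5.8) of Tao–Teräväinen (arXiv:2109.06291, §5, proof of Proposition 5.2) at `k = 2`, `ℓ = 0`.
Everything here is PROVED.

The source, after applying Lemma 3.4: "we can bound the left-hand side of (5.8) by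
`≪ log_R^{O(1)} x ∫₁^∞ (∑_{d₁,…,d_k ∈ ℕ_{≤R₀}, d₁>1} (∏ τ(d_j)^{O(1)})/d · ∏_{p∣d₁…d_k} min(σ log_R p, 1)) dσ/σ^A
+ R^{2k} D^{k+1} (log^k x)/x` … Using Euler products (2.11), we can bound this by
`log_R^{O(1)} x ∫₁^∞ (∏_{p≤R} E'_p(σ) - 1) dσ/σ^A` where `E'_p(σ) = 1 + O(min(σ log_R p,1)/p)` when
`p ≤ R₀` … From (3.3) we have `∏_{p ≤ R} E'_p(σ) ≪ exp(O(log(1+σ log_R R₀))) ≪ (1+σ log_R R₀)^{O(1)}`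
and hence … `≪ log_R^{O(1)} x · log_R R₀`." [cite: TaoTeravainen2021, §5 (proof of (5.8))]

Here, with the tree's `gainWeight R d σ = 1944^{ω(d₀d₁)}/(d₀d₁) ∏_{p∣d₀d₁,p<R} min(σ log_R p,1)`
(`…SieveLocal.lean`) as the output of Lemma 3.4:
* identities expressing `τ(d)`, `d`, `c^{ω(d)}`, `∏_{p∣d} f(p)` through the valuations on a set
  `S ⊇ primeFactors d`;
* local weights `locW A p i = (i+1)^A 1944^{[i>0]} p^{-i}`, `locW₂` (with the gain `min(σ log_R p,1)`
  as soon as `i + j > 0`), `pairW S R σ A d₁ d₂ = ∏_{p∈S} locW₂(v_p d₁, v_p d₂)`, and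
  `tau_pow_mul_gainWeight_le`: `τ(d₁)^A τ(d₂)^A gainWeight(R;(d₁,d₂);σ) ≤ pairW` for smooth pairs;
* `sum_locW_succ_le` (`∑_{1≤i≤K} locW ≤ c_A/p`), `sum_locW₂_le` (`E'_p ≤ 1 + c'_A min(σ log_R p,1)/p`),
  `sum_pairW_le` (`∑_{d₁,d₂∣Q} pairW = ∏_p E'_p ≤ (1 + σ log M'/log R)^{N_A}`, via
  `sum_divisors_pair_eq_prod` and (3.3) `sum_min_div_prime_le_log`), and **`sum_pairW_erase_le`**:
  `∑_{(d₁,d₂)≠(1,1)} pairW ≤ N_A 2^{N_A} (log M'/log R) σ^{N_A+1}` — the gain `log_R R₀`.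
Constants: `kappaA`, `cA`, `cA'`, `expN A = 40⌈c'_A⌉`.
-/

noncomputable section

open Finset

namespace Literature.Barriers.Parity

namespace TaoTeravainen

/-! ### Arithmetic functions of a number with prime factors in `S`, via valuations -/

/-- `τ(d) = ∏_{p ∈ S} (v_p d + 1)` when `primeFactors d ⊆ S`, `d ≠ 0`. [folklore] -/
theorem card_divisors_eq_prod_of_subset {S : Finset ℕ} {d : ℕ} (hd : d ≠ 0) (hS : d.primeFactors ⊆ S) :
    (d.divisors.card : ℝ) = ∏ p ∈ S, ((d.factorization p : ℝ) + 1) := by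
  rw [Nat.card_divisors hd]
  push_cast
  refine Finset.prod_subset hS fun p _ hp => ?_
  rw [Finsupp.notMem_support_iff.mp (by rwa [Nat.support_factorization]), Nat.cast_zero, zero_add]

/-- `d = ∏_{p ∈ S} p^{v_p d}` when `primeFactors d ⊆ S`, `d ≠ 0`. [folklore] -/
theorem eq_prod_pow_factorization_of_subset {S : Finset ℕ} {d : ℕ} (hd : d ≠ 0) (hS : d.primeFactors ⊆ S) :
    (d : ℝ) = ∏ p ∈ S, (p : ℝ) ^ d.factorization p := by
  have h := Nat.prod_factorization_pow_eq_self hd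
  rw [Nat.prod_factorization_eq_prod_primeFactors] at h
  conv_lhs => rw [← h]
  push_cast
  refine Finset.prod_subset hS fun p _ hp => ?_
  rw [Finsupp.notMem_support_iff.mp (by rwa [Nat.support_factorization]), pow_zero]

/-- `c^{ω(d)} = ∏_{p ∈ S} (c if v_p d > 0 else 1)` when `primeFactors d ⊆ S`. [folklore] -/
theorem pow_card_primeFactors_eq_prod {S : Finset ℕ} {d : ℕ} (hS : d.primeFactors ⊆ S) (c : ℝ) :
    c ^ d.primeFactors.card = ∏ p ∈ S, (if 0 < d.factorization p then c else 1) := by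
  classical
  rw [Finset.prod_ite, Finset.prod_const_one, mul_one, Finset.prod_const]
  congr 1
  congr 1
  ext p
  rw [Finset.mem_filter, ← Nat.support_factorization, Finsupp.mem_support_iff, pos_iff_ne_zero]
  constructor
  · intro h
    exact ⟨hS (by rwa [← Nat.support_factorization, Finsupp.mem_support_iff]), h⟩
  · exact fun h => h.2

/-- `∏_{p ∣ d} f p = ∏_{p ∈ S} (f p if v_p d > 0 else 1)` when `primeFactors d ⊆ S`. [folklore] -/
theorem prod_primeFactors_eq_prod_ite {S : Finset ℕ} {d : ℕ} (hS : d.primeFactors ⊆ S) (f : ℕ → ℝ) :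
    ∏ p ∈ d.primeFactors, f p = ∏ p ∈ S, (if 0 < d.factorization p then f p else 1) := by
  classical
  rw [← Finset.prod_filter]
  congr 1
  ext p
  rw [Finset.mem_filter, ← Nat.support_factorization, Finsupp.mem_support_iff, pos_iff_ne_zero]
  constructor
  · intro h
    exact ⟨hS (by rwa [← Nat.support_factorization, Finsupp.mem_support_iff]), h⟩
  · exact fun h => h.2

/-- For `σ ≥ 1` the gains of the primes `≥ R` are `1`, so the product in `gainWeight` may be
taken over all prime factors of `d₀d₁`: `gainWeight R d σ = 1944^{ω}/(d₀d₁) ∏_{p ∣ d₀d₁} min(σ log_R p, 1)`.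
[cite: TaoTeravainen2021, §3.2 (proof of Lemma 3.4: the factors `min(σ log_R p, 1)`)] -/
theorem gainWeight_eq_primeFactors {R : ℝ} (hR : 1 < R) {σ : ℝ} (hσ : 1 ≤ σ) {d : Fin 2 → ℕ}
    (hd : ∀ j, d j ≠ 0) :
    gainWeight R d σ = (1944 : ℝ) ^ (d 0 * d 1).primeFactors.card / ((d 0 : ℝ) * d 1) *
      ∏ p ∈ (d 0 * d 1).primeFactors, gainMin R σ p := by
  classical
  have h01 : d 0 * d 1 ≠ 0 := mul_ne_zero (hd 0) (hd 1)
  have hlogR : 0 < Real.log R := Real.log_pos hR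
  unfold gainWeight
  congr 1
  have hsub : (sievePrimes R).filter (fun p => p ∣ d 0 * d 1) ⊆ (d 0 * d 1).primeFactors := by
    intro p hp
    rw [Finset.mem_filter, mem_sievePrimes] at hp
    exact Nat.mem_primeFactors.mpr ⟨hp.1.2, hp.2, h01⟩
  refine Finset.prod_subset hsub fun p hp hnot => ?_
  -- `p ∣ d₀d₁` prime with `p ∉ sievePrimes R`, i.e. `p ≥ R`: the gain is `1`
  have hpp : p.Prime := Nat.prime_of_mem_primeFactors hp
  have hpR : R ≤ p := by
    by_contra h
    push Not at h
    exact hnot (Finset.mem_filter.mpr ⟨mem_sievePrimes.mpr ⟨h, hpp⟩, Nat.dvd_of_mem_primeFactors hp⟩)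
  unfold gainMin
  refine min_eq_right ?_
  rw [le_div_iff₀ hlogR, one_mul]
  have hlogp : Real.log R ≤ Real.log p := Real.log_le_log (by linarith) hpR
  have hlogp0 : 0 ≤ Real.log p := hlogR.le.trans hlogp
  nlinarith

/-! ### The local weights -/

/-- The one-variable local weight `c_p(i) = (i+1)^A 1944^{[i>0]} p^{-i}`. [cite: TaoTeravainen2021, §5 (proof of (5.8), the Euler factors `E'_p`)] -/
def locW (A p i : ℕ) : ℝ :=
  ((i : ℝ) + 1) ^ A * (if 0 < i then (1944 : ℝ) else 1) / (p : ℝ) ^ i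

/-- `c_p(i) ≥ 0`. [folklore] -/
theorem locW_nonneg (A p i : ℕ) : 0 ≤ locW A p i := by
  unfold locW
  have : (0 : ℝ) ≤ (if 0 < i then (1944 : ℝ) else 1) := by split_ifs <;> norm_num
  positivity

/-- `c_p(0) = 1`. [folklore] -/
@[simp] theorem locW_zero (A p : ℕ) : locW A p 0 = 1 := by
  simp [locW]

/-- The two-variable local weight `Φ_p(i,j) = c_p(i) c_p(j) (μ_p if i+j>0 else 1)`.
[cite: TaoTeravainen2021, §5 (proof of (5.8), the Euler factors `E'_p`)] -/
def locW₂ (R σ : ℝ) (A p i j : ℕ) : ℝ :=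
  locW A p i * locW A p j * (if 0 < i + j then gainMin R σ p else 1)

/-- The global weight `Φ(d₁,d₂) = ∏_{p ∈ S} Φ_p(v_p d₁, v_p d₂)`. [cite: TaoTeravainen2021, §5 (proof of (5.8))] -/
def pairW (S : Finset ℕ) (R σ : ℝ) (A d₁ d₂ : ℕ) : ℝ :=
  ∏ p ∈ S, locW₂ R σ A p (d₁.factorization p) (d₂.factorization p)

/-- `Φ ≥ 0` (for `σ ≥ 0`, `R > 1`). [folklore] -/
theorem pairW_nonneg {S : Finset ℕ} (hS : ∀ p ∈ S, p.Prime) {R : ℝ} (hR : 1 < R) {σ : ℝ} (hσ : 0 ≤ σ)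
    (A d₁ d₂ : ℕ) : 0 ≤ pairW S R σ A d₁ d₂ := by
  unfold pairW locW₂
  refine Finset.prod_nonneg fun p hp => mul_nonneg (mul_nonneg (locW_nonneg _ _ _) (locW_nonneg _ _ _)) ?_
  split_ifs
  · exact gainMin_nonneg hR hσ (hS p hp).one_lt.le
  · exact zero_le_one

/-- `Φ(1,1) = 1`. [folklore] -/
theorem pairW_one_one (S : Finset ℕ) (R σ : ℝ) (A : ℕ) : pairW S R σ A 1 1 = 1 := by
  unfold pairW locW₂
  simp

/-- **The weighted gain of a smooth pair is dominated by `Φ`**: for `d₁, d₂ ≥ 1` with all prime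
factors in `S`, a set of primes `< R`, and `σ ≥ 1`,
`τ(d₁)^A τ(d₂)^A · gainWeight(R; (d₁,d₂); σ) ≤ Φ(d₁,d₂)`
(`ω(d₁d₂) ≤ ω(d₁) + ω(d₂)`, and `∏_{p∣d₁d₂, p<R} min = ∏_{p ∈ S: v_p d₁ + v_p d₂ > 0} min`).
[cite: TaoTeravainen2021, §5 (proof of (5.8): "we can bound the left-hand side of (5.8) by `≪ log_R^{O(1)} x ∫₁^∞ ∑ ∏ τ(d_j)^{O(1)}/d · ∏_{p∣d₁⋯d_k} min(σ log_R p,1) dσ/σ^A`")] -/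
theorem tau_pow_mul_gainWeight_le {S : Finset ℕ} {R : ℝ} (hR : 1 < R) {σ : ℝ} (hσ : 1 ≤ σ)
    (A : ℕ) {d₁ d₂ : ℕ} (hd₁ : d₁ ≠ 0) (hd₂ : d₂ ≠ 0) (h₁S : d₁.primeFactors ⊆ S)
    (h₂S : d₂.primeFactors ⊆ S) :
    (d₁.divisors.card : ℝ) ^ A * (d₂.divisors.card : ℝ) ^ A * gainWeight R ![d₁, d₂] σ ≤
      pairW S R σ A d₁ d₂ := by
  classical
  have hσ0 : 0 ≤ σ := by linarith
  have h12 : d₁ * d₂ ≠ 0 := mul_ne_zero hd₁ hd₂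
  have h12S : (d₁ * d₂).primeFactors ⊆ S := by
    rw [Nat.primeFactors_mul hd₁ hd₂]
    exact Finset.union_subset h₁S h₂S
  -- unfold `gainWeight` at `![d₁, d₂]`; the primes `≥ R` dividing `d₁d₂` have gain `1` (`σ ≥ 1`)
  have hgw : gainWeight R ![d₁, d₂] σ =
      (1944 : ℝ) ^ (d₁ * d₂).primeFactors.card / ((d₁ : ℝ) * d₂) *
        ∏ p ∈ (d₁ * d₂).primeFactors, gainMin R σ p := by
    rw [gainWeight_eq_primeFactors hR hσ (d := ![d₁, d₂]) (by
      intro j; fin_cases j <;> simpa)]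
    simp only [Matrix.cons_val_zero, Matrix.cons_val_one]
  rw [hgw]
  -- `ω(d₁d₂) ≤ ω(d₁) + ω(d₂)`
  have hω : (1944 : ℝ) ^ (d₁ * d₂).primeFactors.card ≤
      (1944 : ℝ) ^ d₁.primeFactors.card * (1944 : ℝ) ^ d₂.primeFactors.card := by
    rw [← pow_add]
    refine pow_le_pow_right₀ (by norm_num) ?_
    rw [Nat.primeFactors_mul hd₁ hd₂]
    exact Finset.card_union_le _ _
  -- everything as products over `S`
  have hτ₁ := card_divisors_eq_prod_of_subset hd₁ h₁S
  have hτ₂ := card_divisors_eq_prod_of_subset hd₂ h₂S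
  have hD₁ := eq_prod_pow_factorization_of_subset hd₁ h₁S
  have hD₂ := eq_prod_pow_factorization_of_subset hd₂ h₂S
  have hΩ₁ := pow_card_primeFactors_eq_prod h₁S (1944 : ℝ)
  have hΩ₂ := pow_card_primeFactors_eq_prod h₂S (1944 : ℝ)
  have hμ : ∏ p ∈ (d₁ * d₂).primeFactors, gainMin R σ p =
      ∏ p ∈ S, (if 0 < d₁.factorization p + d₂.factorization p then gainMin R σ p else 1) := by
    rw [prod_primeFactors_eq_prod_ite h12S]
    refine Finset.prod_congr rfl fun p _ => ?_
    rw [Nat.factorization_mul hd₁ hd₂, Finsupp.add_apply]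
  have hμ0 : 0 ≤ ∏ p ∈ (d₁ * d₂).primeFactors, gainMin R σ p :=
    Finset.prod_nonneg fun p hp => gainMin_nonneg hR hσ0 (Nat.prime_of_mem_primeFactors hp).one_lt.le
  have hd0 : (0 : ℝ) < (d₁ : ℝ) * d₂ := by
    have := Nat.pos_of_ne_zero hd₁
    have := Nat.pos_of_ne_zero hd₂
    positivity
  calc (d₁.divisors.card : ℝ) ^ A * (d₂.divisors.card : ℝ) ^ A *
        ((1944 : ℝ) ^ (d₁ * d₂).primeFactors.card / ((d₁ : ℝ) * d₂) *
          ∏ p ∈ (d₁ * d₂).primeFactors, gainMin R σ p)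
      ≤ (d₁.divisors.card : ℝ) ^ A * (d₂.divisors.card : ℝ) ^ A *
        ((1944 : ℝ) ^ d₁.primeFactors.card * (1944 : ℝ) ^ d₂.primeFactors.card / ((d₁ : ℝ) * d₂) *
          ∏ p ∈ (d₁ * d₂).primeFactors, gainMin R σ p) := by
        gcongr
    _ = pairW S R σ A d₁ d₂ := by
        rw [hμ, hτ₁, hτ₂, hΩ₁, hΩ₂]
        conv_lhs => rw [hD₁, hD₂]
        unfold pairW locW₂ locW
        simp only [Finset.prod_mul_distrib, Finset.prod_div_distrib, Finset.prod_pow]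
        ring


/-! ### The local sums -/

/-- `κ_A = 2^A A!/(log 3/2)^A`, with `(i+1)^A ≤ κ_A (3/2)^i` for `i ≥ 1`. [folklore] -/
def kappaA (A : ℕ) : ℝ :=
  2 ^ A * A.factorial / Real.log (3 / 2) ^ A

/-- `κ_A > 0`. [folklore] -/
theorem kappaA_pos (A : ℕ) : 0 < kappaA A := by
  unfold kappaA
  have : 0 < Real.log (3 / 2) := Real.log_pos (by norm_num)
  positivity

/-- `(i+1)^A ≤ κ_A (3/2)^i` for `i ≥ 1` (from `y^A/A! ≤ e^y` at `y = i log(3/2)`). [folklore] -/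
theorem succ_pow_le_kappaA_mul (A : ℕ) {i : ℕ} (hi : 1 ≤ i) :
    ((i : ℝ) + 1) ^ A ≤ kappaA A * (3 / 2 : ℝ) ^ i := by
  have hl : 0 < Real.log (3 / 2) := Real.log_pos (by norm_num)
  have hi1 : (1 : ℝ) ≤ i := by exact_mod_cast hi
  have hy : 0 ≤ (i : ℝ) * Real.log (3 / 2) := by positivity
  have h1 := @Real.pow_div_factorial_le_exp ((i : ℝ) * Real.log (3 / 2)) hy A
  have hexp : Real.exp ((i : ℝ) * Real.log (3 / 2)) = (3 / 2 : ℝ) ^ i := by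
    rw [← Real.log_pow, Real.exp_log (by positivity)]
  rw [hexp, mul_pow, div_le_iff₀ (by positivity)] at h1
  -- `i^A ≤ A! (3/2)^i / log(3/2)^A`
  have hfact : (0 : ℝ) < A.factorial := by exact_mod_cast Nat.factorial_pos A
  have h2 : (i : ℝ) ^ A ≤ A.factorial * (3 / 2 : ℝ) ^ i / Real.log (3 / 2) ^ A := by
    rw [le_div_iff₀ (pow_pos hl A)]
    linarith
  have h3 : ((i : ℝ) + 1) ^ A ≤ (2 * (i : ℝ)) ^ A :=
    pow_le_pow_left₀ (by positivity) (by linarith) A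
  calc ((i : ℝ) + 1) ^ A ≤ (2 * (i : ℝ)) ^ A := h3
    _ = 2 ^ A * (i : ℝ) ^ A := mul_pow _ _ _
    _ ≤ 2 ^ A * (A.factorial * (3 / 2 : ℝ) ^ i / Real.log (3 / 2) ^ A) :=
        mul_le_mul_of_nonneg_left h2 (by positivity)
    _ = kappaA A * (3 / 2 : ℝ) ^ i := by unfold kappaA; ring

/-- `c_A = 1944 · 6 · κ_A`. [folklore] -/
def cA (A : ℕ) : ℝ :=
  1944 * 6 * kappaA A

/-- `c'_A = c_A (2 + c_A/2)`. [folklore] -/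
def cA' (A : ℕ) : ℝ :=
  cA A * (2 + cA A / 2)

/-- `c_A > 0`. [folklore] -/
theorem cA_pos (A : ℕ) : 0 < cA A := by
  unfold cA; have := kappaA_pos A; positivity

/-- `c'_A > 0`. [folklore] -/
theorem cA'_pos (A : ℕ) : 0 < cA' A := by
  unfold cA'; have := cA_pos A; positivity

/-- **The tail of the local series**: `t_p = ∑_{1 ≤ i ≤ K} (i+1)^A 1944 p^{-i} ≤ c_A/p` for a prime `p`
(uniformly in `K`; geometric comparison with ratio `3/(2p) ≤ 3/4`). [cite: TaoTeravainen2021, §5 (proof of (5.8): "`E'_p(σ) = 1 + O(min(σ log_R p,1)/p)`")] -/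
theorem sum_locW_succ_le (A : ℕ) {p : ℕ} (hp : 2 ≤ p) (K : ℕ) :
    ∑ i ∈ Finset.range K, locW A p (i + 1) ≤ cA A / p := by
  have hp0 : (0 : ℝ) < p := by exact_mod_cast (show 0 < p by omega)
  have hp2 : (2 : ℝ) ≤ p := by exact_mod_cast hp
  set r : ℝ := 3 / 2 / p with hr
  have hr0 : 0 ≤ r := by positivity
  have hr34 : r ≤ 3 / 4 := by
    rw [hr, div_le_iff₀ hp0]; linarith
  have hr1 : r < 1 := by linarith
  have hκ := kappaA_pos A
  -- termwise
  have hterm : ∀ i ∈ Finset.range K, locW A p (i + 1) ≤ 1944 * kappaA A * (r * r ^ i) := by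
    intro i _
    unfold locW
    rw [if_pos (Nat.succ_pos i)]
    have h1 := succ_pow_le_kappaA_mul A (Nat.le_add_left 1 i)
    push_cast at h1 ⊢
    have hpi : (0 : ℝ) < (p : ℝ) ^ (i + 1) := by positivity
    rw [div_le_iff₀ hpi]
    have hrr : r * r ^ i * (p : ℝ) ^ (i + 1) = (3 / 2 : ℝ) ^ (i + 1) := by
      rw [← pow_succ', hr, div_pow, div_mul_cancel₀ _ hpi.ne']
    calc ((i : ℝ) + 1 + 1) ^ A * 1944 ≤ kappaA A * (3 / 2 : ℝ) ^ (i + 1) * 1944 := by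
          nlinarith [h1]
      _ = 1944 * kappaA A * (r * r ^ i) * (p : ℝ) ^ (i + 1) := by rw [mul_assoc (1944 * kappaA A), hrr]; ring
  have hgeom : ∑ i ∈ Finset.range K, r ^ i ≤ 4 := by
    have h := geom_sum_eq hr1.ne K
    rw [h]
    have h4 : 0 < 1 - r := by linarith
    rw [div_le_iff_of_neg (by linarith : r - 1 < 0)]
    have : 0 ≤ r ^ K := pow_nonneg hr0 K
    nlinarith
  calc ∑ i ∈ Finset.range K, locW A p (i + 1)
      ≤ ∑ i ∈ Finset.range K, 1944 * kappaA A * (r * r ^ i) := Finset.sum_le_sum hterm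
    _ = 1944 * kappaA A * r * ∑ i ∈ Finset.range K, r ^ i := by
        rw [Finset.mul_sum]; exact Finset.sum_congr rfl fun i _ => by ring
    _ ≤ 1944 * kappaA A * r * 4 := mul_le_mul_of_nonneg_left hgeom (by positivity)
    _ ≤ cA A / p := by
        rw [hr, cA, le_div_iff₀ hp0]
        have : 1944 * kappaA A * (3 / 2 / (p : ℝ)) * 4 * p = 1944 * 6 * kappaA A := by
          field_simp
          norm_num
        rw [this]

/-- **The local sum**: `∑_{i,j ≤ K} Φ_p(i,j) = 1 + μ_p (2t_p + t_p²) ≤ 1 + c'_A μ_p/p` for a prime `p`.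
[cite: TaoTeravainen2021, §5 (proof of (5.8): "`E'_p(σ) = 1 + O(min(σ log_R p,1)/p)` when `p ≤ R₀`")] -/
theorem sum_locW₂_le {R : ℝ} (hR : 1 < R) {σ : ℝ} (hσ : 0 ≤ σ) (A : ℕ) {p : ℕ} (hp : 2 ≤ p) (K : ℕ) :
    ∑ i ∈ Finset.range (K + 1), ∑ j ∈ Finset.range (K + 1), locW₂ R σ A p i j ≤
      1 + cA' A * gainMin R σ p / p := by
  have hp0 : (0 : ℝ) < p := by exact_mod_cast (show 0 < p by omega)
  set mu := gainMin R σ p with hmu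
  have hmu0 : 0 ≤ mu := gainMin_nonneg hR hσ (by omega)
  have hmu1 : mu ≤ 1 := gainMin_le_one _ _ _
  set c : ℕ → ℝ := fun i => locW A p i with hc
  set t : ℝ := ∑ i ∈ Finset.range K, c (i + 1) with ht
  have ht0 : 0 ≤ t := Finset.sum_nonneg fun i _ => locW_nonneg _ _ _
  have htb : t ≤ cA A / p := sum_locW_succ_le A hp K
  have hsumc : ∑ i ∈ Finset.range (K + 1), c i = 1 + t := by
    rw [Finset.sum_range_succ', ht]
    simp [hc]
    ring
  -- the identity `∑∑ Φ = μ (∑ c)² + (1 - μ)`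
  have hpt : ∀ i j : ℕ, locW₂ R σ A p i j =
      mu * (c i * c j) + (1 - mu) * (if i = 0 ∧ j = 0 then 1 else 0) := by
    intro i j
    unfold locW₂
    by_cases h : i = 0 ∧ j = 0
    · obtain ⟨rfl, rfl⟩ := h
      simp [hc]
    · rw [if_pos (by omega), if_neg h]
      simp only [hc]; ring
  have hsum : ∑ i ∈ Finset.range (K + 1), ∑ j ∈ Finset.range (K + 1), locW₂ R σ A p i j =
      mu * (1 + t) ^ 2 + (1 - mu) := by
    simp_rw [hpt]
    rw [Finset.sum_comm]
    simp only [Finset.sum_add_distrib, ← Finset.mul_sum]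
    congr 1
    · rw [Finset.sum_comm, ← hsumc, sq, Finset.sum_mul_sum]
    · have : ∑ x ∈ Finset.range (K + 1), ∑ i ∈ Finset.range (K + 1),
          (if i = 0 ∧ x = 0 then (1 : ℝ) else 0) = 1 := by
        rw [Finset.sum_eq_single 0, Finset.sum_eq_single 0]
        · simp
        · intro i _ hi; simp [hi]
        · intro h; simp at h
        · intro x _ hx
          exact Finset.sum_eq_zero fun i _ => by simp [hx]
        · intro h; simp at h
      rw [this, mul_one]
  rw [hsum]
  -- `μ(1+t)² + 1 - μ = 1 + μ(2t + t²) ≤ 1 + μ c'(A)/p`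
  have hcA := cA_pos A
  have ht2 : t ≤ cA A / 2 := htb.trans (by
    rw [div_le_div_iff_of_pos_left hcA hp0 two_pos]; exact_mod_cast hp)
  have hkey : 2 * t + t ^ 2 ≤ cA' A / p := by
    calc 2 * t + t ^ 2 = t * (2 + t) := by ring
      _ ≤ (cA A / p) * (2 + cA A / 2) :=
          mul_le_mul htb (by linarith) (by linarith) (by positivity)
      _ = cA' A / p := by unfold cA'; ring
  have h1 : mu * (1 + t) ^ 2 + (1 - mu) = 1 + mu * (2 * t + t ^ 2) := by ring
  have h2 : mu * (2 * t + t ^ 2) ≤ mu * (cA' A / p) := mul_le_mul_of_nonneg_left hkey hmu0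
  have h3 : mu * (cA' A / p) = cA' A * mu / p := by ring
  linarith


/-! ### The Euler product and the global bound -/

/-- The exponent `N_A = 40 ⌈c'_A⌉`. [folklore] -/
def expN (A : ℕ) : ℕ :=
  40 * ⌈cA' A⌉₊

/-- **The Euler product bound**: for `S` the primes `≤ M'` (`2 ≤ M' < R`), `σ ≥ 1` and any `K`,
`∑_{d₁,d₂ ∣ Q_S(K)} Φ(d₁,d₂) = ∏_{p ≤ M'} ∑_{i,j ≤ K} Φ_p(i,j) ≤ ∏_{p ≤ M'} (1 + c'_A min(σ log_R p,1)/p)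
 ≤ exp(40 c'_A log(1 + σ log M'/log R)) ≤ (1 + σ log M'/log R)^{N_A}`
("Using Euler products (2.11) … `∏_{p ≤ R} E'_p(σ) - 1` … From (3.3) we have
`∏_{p≤R} E'_p(σ) ≪ exp(O(log(1 + σ log_R R₀))) ≪ (1 + σ log_R R₀)^{O(1)}`").
[cite: TaoTeravainen2021, §5 (proof of (5.8))] -/
theorem sum_pairW_le {M' : ℕ} (hM' : 2 ≤ M') {R : ℝ} (hM'R : (M' : ℝ) < R) {σ : ℝ} (hσ : 1 ≤ σ)
    (A K : ℕ) :
    ∑ d₁ ∈ (primePowerProd (Nat.primesBelow (M' + 1)) K).divisors,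
        ∑ d₂ ∈ (primePowerProd (Nat.primesBelow (M' + 1)) K).divisors,
          pairW (Nat.primesBelow (M' + 1)) R σ A d₁ d₂ ≤
      (1 + σ * Real.log M' / Real.log R) ^ expN A := by
  set S := Nat.primesBelow (M' + 1) with hSdef
  have hS : ∀ p ∈ S, p.Prime := fun p hp => (Nat.mem_primesBelow.mp hp).2
  have hSM : ∀ p ∈ S, p ≤ M' := fun p hp => Nat.lt_succ_iff.mp (Nat.mem_primesBelow.mp hp).1
  have hM'2 : (2 : ℝ) ≤ M' := by exact_mod_cast hM'
  have hR : 1 < R := by linarith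
  have hσ0 : 0 ≤ σ := by linarith
  have hL : Real.log M' ≤ Real.log R := Real.log_le_log (by linarith) hM'R.le
  have hu0 : 0 ≤ σ * Real.log M' / Real.log R := by
    have := Real.log_nonneg (by linarith : (1 : ℝ) ≤ M')
    have := Real.log_pos hR
    positivity
  -- Euler product
  have hE : ∑ d₁ ∈ (primePowerProd S K).divisors, ∑ d₂ ∈ (primePowerProd S K).divisors,
      pairW S R σ A d₁ d₂ = ∏ p ∈ S, ∑ i ∈ Finset.range (K + 1), ∑ j ∈ Finset.range (K + 1),
        locW₂ R σ A p i j := sum_divisors_pair_eq_prod hS K (fun p i j => locW₂ R σ A p i j)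
  rw [hE]
  -- local bounds
  have hloc0 : ∀ p ∈ S, 0 ≤ ∑ i ∈ Finset.range (K + 1), ∑ j ∈ Finset.range (K + 1), locW₂ R σ A p i j := by
    intro p hp
    refine Finset.sum_nonneg fun i _ => Finset.sum_nonneg fun j _ => ?_
    unfold locW₂
    refine mul_nonneg (mul_nonneg (locW_nonneg _ _ _) (locW_nonneg _ _ _)) ?_
    split_ifs
    · exact gainMin_nonneg hR hσ0 (hS p hp).one_lt.le
    · exact zero_le_one
  have h33 : ∑ p ∈ S, gainMin R σ p / p ≤ 40 * Real.log (1 + σ * Real.log M' / Real.log R) := by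
    have := sum_min_div_prime_le_log hM' hσ hL
    simpa [gainMin] using this
  calc ∏ p ∈ S, ∑ i ∈ Finset.range (K + 1), ∑ j ∈ Finset.range (K + 1), locW₂ R σ A p i j
      ≤ ∏ p ∈ S, Real.exp (cA' A * (gainMin R σ p / p)) := by
        refine Finset.prod_le_prod hloc0 fun p hp => ?_
        refine (sum_locW₂_le hR hσ0 A (hS p hp).two_le K).trans ?_
        have := Real.add_one_le_exp (cA' A * (gainMin R σ p / p))
        rw [mul_div_assoc] at *
        linarith
    _ = Real.exp (cA' A * ∑ p ∈ S, gainMin R σ p / p) := by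
        rw [← Real.exp_sum, Finset.mul_sum]
    _ ≤ Real.exp ((expN A : ℝ) * Real.log (1 + σ * Real.log M' / Real.log R)) := by
        refine Real.exp_le_exp.mpr ?_
        have hc := cA'_pos A
        have hlog0 : 0 ≤ Real.log (1 + σ * Real.log M' / Real.log R) := Real.log_nonneg (by linarith)
        have hceil : cA' A ≤ (⌈cA' A⌉₊ : ℝ) := Nat.le_ceil _
        calc cA' A * ∑ p ∈ S, gainMin R σ p / p
            ≤ cA' A * (40 * Real.log (1 + σ * Real.log M' / Real.log R)) :=
              mul_le_mul_of_nonneg_left h33 hc.le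
          _ = (40 * cA' A) * Real.log (1 + σ * Real.log M' / Real.log R) := by ring
          _ ≤ (expN A : ℝ) * Real.log (1 + σ * Real.log M' / Real.log R) := by
              refine mul_le_mul_of_nonneg_right ?_ hlog0
              unfold expN
              push_cast
              linarith
    _ = (1 + σ * Real.log M' / Real.log R) ^ expN A := by
        rw [Real.exp_nat_mul, Real.exp_log (by linarith : (0 : ℝ) < 1 + σ * Real.log M' / Real.log R)]

/-- **The gain bound for the pairs other than `(1,1)`**:
`∑_{(d₁,d₂) ≠ (1,1)} Φ(d₁,d₂) ≤ (1 + σℓ)^{N_A} - 1 ≤ N_A 2^{N_A} ℓ σ^{N_A+1}`, `ℓ = log M'/log R ≤ 1`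
("`∫₁^∞ ((1 + σ log_R R₀)^{O(1)} - 1) dσ/σ^A ≪ log_R R₀`" — the gain). [cite: TaoTeravainen2021, §5 (proof of (5.8), conclusion)] -/
theorem sum_pairW_erase_le {M' : ℕ} (hM' : 2 ≤ M') {R : ℝ} (hM'R : (M' : ℝ) < R) {σ : ℝ} (hσ : 1 ≤ σ)
    (A K : ℕ) :
    ∑ dd ∈ ((primePowerProd (Nat.primesBelow (M' + 1)) K).divisors ×ˢ
        (primePowerProd (Nat.primesBelow (M' + 1)) K).divisors).erase (1, 1),
          pairW (Nat.primesBelow (M' + 1)) R σ A dd.1 dd.2 ≤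
      (expN A : ℝ) * 2 ^ expN A * (Real.log M' / Real.log R) * σ ^ (expN A + 1) := by
  classical
  set S := Nat.primesBelow (M' + 1) with hSdef
  set Q := primePowerProd S K with hQdef
  set N := expN A with hNdef
  have hS : ∀ p ∈ S, p.Prime := fun p hp => (Nat.mem_primesBelow.mp hp).2
  have hM'2 : (2 : ℝ) ≤ M' := by exact_mod_cast hM'
  have hR : 1 < R := by linarith
  have hσ0 : 0 ≤ σ := by linarith
  have hlogR : 0 < Real.log R := Real.log_pos hR
  have hlogM : 0 ≤ Real.log M' := Real.log_nonneg (by linarith)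
  set ℓ := Real.log M' / Real.log R with hℓ
  have hℓ0 : 0 ≤ ℓ := by positivity
  have hℓ1 : ℓ ≤ 1 := by
    rw [hℓ, div_le_one hlogR]
    exact Real.log_le_log (by linarith) hM'R.le
  have hQ0 : Q ≠ 0 := primePowerProd_ne_zero hS K
  have h11 : ((1 : ℕ), (1 : ℕ)) ∈ Q.divisors ×ˢ Q.divisors := by
    rw [Finset.mem_product]
    exact ⟨Nat.one_mem_divisors.mpr hQ0, Nat.one_mem_divisors.mpr hQ0⟩
  have htot := sum_pairW_le hM' hM'R hσ A K
  rw [← Finset.sum_product'] at htot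
  have hsplit := Finset.add_sum_erase (Q.divisors ×ˢ Q.divisors)
    (fun dd : ℕ × ℕ => pairW S R σ A dd.1 dd.2) h11
  simp only [pairW_one_one] at hsplit
  have herase : ∑ dd ∈ (Q.divisors ×ˢ Q.divisors).erase (1, 1), pairW S R σ A dd.1 dd.2 ≤
      (1 + σ * Real.log M' / Real.log R) ^ N - 1 := by linarith
  refine herase.trans ?_
  have hy : 0 ≤ σ * ℓ := by positivity
  -- `(1+y)^n - 1 ≤ n y (1+y)^n` for `y ≥ 0` (also in the tree's HeathBrownCubicHatCore, not imported here)
  have one_add_pow_sub_one_le_mul : ∀ {y : ℝ}, 0 ≤ y → ∀ n : ℕ,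
      (1 + y) ^ n - 1 ≤ n * y * (1 + y) ^ n := by
    intro y hy n
    have h := geom_sum_mul (1 + y) n
    rw [add_sub_cancel_left] at h
    rw [← h]
    have hle : ∑ i ∈ Finset.range n, (1 + y) ^ i ≤ n * (1 + y) ^ n := by
      calc ∑ i ∈ Finset.range n, (1 + y) ^ i ≤ ∑ _i ∈ Finset.range n, (1 + y) ^ n :=
            Finset.sum_le_sum fun i hi =>
              pow_le_pow_right₀ (by linarith) (Finset.mem_range.mp hi).le
        _ = n * (1 + y) ^ n := by rw [Finset.sum_const, Finset.card_range, nsmul_eq_mul]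
    nlinarith
  have h1 : (1 + σ * Real.log M' / Real.log R) ^ N - 1 ≤ N * (σ * ℓ) * (1 + σ * ℓ) ^ N := by
    have := one_add_pow_sub_one_le_mul hy N
    have e : σ * ℓ = σ * Real.log M' / Real.log R := by rw [hℓ, mul_div_assoc]
    rwa [e] at this ⊢
  refine h1.trans ?_
  -- `(1 + σℓ)^N ≤ (2σ)^N`
  have h2 : (1 + σ * ℓ) ^ N ≤ (2 * σ) ^ N := by
    refine pow_le_pow_left₀ (by positivity) ?_ N
    nlinarith
  calc (N : ℝ) * (σ * ℓ) * (1 + σ * ℓ) ^ N ≤ (N : ℝ) * (σ * ℓ) * (2 * σ) ^ N :=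
        mul_le_mul_of_nonneg_left h2 (by positivity)
    _ = (N : ℝ) * 2 ^ N * ℓ * σ ^ (N + 1) := by rw [mul_pow, pow_succ]; ring

end TaoTeravainen

end Literature.Barriers.Parity
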